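/-
K2-LIT rung 3 ∕ ED. 3 (prover seat hodgecm-mathlib-K2E1-p05, gen 2): 5R FOR A SUPERCUSPIDAL `ρ₀` OF `U(Φ₂)(L⁺_v)`, `v` NON-SPLIT, MODULO GGPS BY NAME AND THE FINITE-COMPONENT TOKEN ONLY.
-/
import Summits.HodgeConjecture.HodgeConjecture.Theorems.K2E1GlobaliseSupercuspidalU2Poincare   -- ★ p855563 ED. 2 (this seat)
import Summits.HodgeConjecture.HodgeConjecture.Theorems.K2E1SiegelRadicalPlaceFactorU2        -- ★ p855767 (A) (this seat) → ★ p855616 (B)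
import HarnessLib

/-!
# 5R for a supercuspidal `ρ₀` of `U(Φ₂)` at a non-split place: (A) and (B) discharged

ED. 3 of the 5R-supercuspidal chain: ★ p855563 `globaliseSupercuspidal_of_poincare` at `Φ := Φ₂`, `𝔓 := cmParabolicData L 2` with its analytic binders
DISCHARGED — (A) by ★ p855767 `adelicCuspVanishing_cmParabolicData_two` (needs `v` NON-SPLIT in `L`, `hns`) and (B) by ★ p855616 `finiteCovolume_cmParabolicData_two`.
RESIDUAL HYPOTHESES (honest list): `hns`; **(H4)** `CuspidalSpectrumDiscrete μH (cmParabolicData L 2)` = Gelfand–Graev–Piatetski-Shapiro BY NAME (socket 5C);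
**(T)** the finite-component ∕ Flath token of ★ p855275 (⟸ ★ p855424 (L1)+(L2)).  (H1), (H2), (H3), (A), (B) are theorems of the tree.
-/

set_option autoImplicit false

set_option linter.dupNamespace false

open MeasureTheory Filter Topology CompactlySupported NumberField IsDedekindDomain
open scoped ComplexConjugate InnerProductSpace ENNReal Classical
open Literature.NumberTheory.Automorphic Literature.NumberTheory.Automorphic.UnitaryGroup Representation
open Summit.HodgeConjecture.HodgeConjecture.Cruxes.H413.F0P3GlobalPacketDiscrete (cmOccursInDiscreteSpectrum)
open Summit.HodgeConjecture.HodgeConjecture.Cruxes.H413.K2E1CuspidalSpectrumUnitary (cmParabolicData)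
open Summit.HodgeConjecture.HodgeConjecture.Cruxes.H413.K2E1GlobaliseSupercuspidalU2Poincare (globaliseSupercuspidal_of_poincare)
open Summit.HodgeConjecture.HodgeConjecture.Cruxes.H413.K2E1SiegelRadicalPlaceFactorU2 (adelicCuspVanishing_cmParabolicData_two)
open Summit.HodgeConjecture.HodgeConjecture.Cruxes.H413.K2E1SiegelRadicalCocompactU2 (finiteCovolume_cmParabolicData_two)

namespace Summit.HodgeConjecture.HodgeConjecture.Cruxes.H413.K2E1GlobaliseSupercuspidalU2PoincareNonsplit

section PhiTwo

variable (L : Type) [Field L] [NumberField L] [IsCMField L] (v : HeightOneSpectrum (𝓞 ↥(maximalRealSubfield L)))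
  [NonarchimedeanGroup ((cmDatum L 2 (Matrix.of fun i j : Fin 2 => if i.val + j.val + 1 = 2 then (1 : L) else 0)).Local v)] [LocallyCompactSpace ((cmDatum L 2 (Matrix.of fun i j : Fin 2 => if i.val + j.val + 1 = 2 then (1 : L) else 0)).Local v)] [T2Space ((cmDatum L 2 (Matrix.of fun i j : Fin 2 => if i.val + j.val + 1 = 2 then (1 : L) else 0)).Local v)]
  [MeasurableSpace ((cmDatum L 2 (Matrix.of fun i j : Fin 2 => if i.val + j.val + 1 = 2 then (1 : L) else 0)).Local v)] [BorelSpace ((cmDatum L 2 (Matrix.of fun i j : Fin 2 => if i.val + j.val + 1 = 2 then (1 : L) else 0)).Local v)]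
  [MeasurableSpace (cmDatum L 2 (Matrix.of fun i j : Fin 2 => if i.val + j.val + 1 = 2 then (1 : L) else 0)).Adelic] [BorelSpace (cmDatum L 2 (Matrix.of fun i j : Fin 2 => if i.val + j.val + 1 = 2 then (1 : L) else 0)).Adelic]
  {V : Type} [AddCommGroup V] [Module ℂ V] {ρ : Representation ℂ ((cmDatum L 2 (Matrix.of fun i j : Fin 2 => if i.val + j.val + 1 = 2 then (1 : L) else 0)).Local v) V} {B : V →ₗ⋆[ℂ] V →ₗ[ℂ] ℂ}
  [ρ.IsIrreducible] (hadm : ρ.IsAdmissible) (hsc : ρ.IsSupercuspidal)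
  (hZ : IsCompact (Subgroup.center ((cmDatum L 2 (Matrix.of fun i j : Fin 2 => if i.val + j.val + 1 = 2 then (1 : L) else 0)).Local v) : Set ((cmDatum L 2 (Matrix.of fun i j : Fin 2 => if i.val + j.val + 1 = 2 then (1 : L) else 0)).Local v)))
  (hBsymm : B.IsSymm) (hBpos : ∀ x : V, x ≠ 0 → 0 < (B x x).re)
  (hBinv : ∀ (g : (cmDatum L 2 (Matrix.of fun i j : Fin 2 => if i.val + j.val + 1 = 2 then (1 : L) else 0)).Local v) (x y : V), B (ρ g x) (ρ g y) = B x y)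
  (ν : Measure ((cmDatum L 2 (Matrix.of fun i j : Fin 2 => if i.val + j.val + 1 = 2 then (1 : L) else 0)).Local v)) [ν.IsHaarMeasure] [ν.IsInvInvariant] {u : V} (hu : u ≠ 0)
  (e : C_c((cmDatum L 2 (Matrix.of fun i j : Fin 2 => if i.val + j.val + 1 = 2 then (1 : L) else 0)).Local v, ℂ)) (he : ∀ g, e g = ((((∫ y, ‖B (ρ y u) u‖ ^ 2 ∂ν) / (B u u).re : ℝ) : ℂ))⁻¹ * B (ρ g u) u)
  (μH : Measure (adelicGroupData (↥(maximalRealSubfield L)) L (IsCMField.complexConj L) 2 (Matrix.of fun i j : Fin 2 => if i.val + j.val + 1 = 2 then (1 : L) else 0)).automorphicQuotient)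
  [(adelicGroupData (↥(maximalRealSubfield L)) L (IsCMField.complexConj L) 2 (Matrix.of fun i j : Fin 2 => if i.val + j.val + 1 = 2 then (1 : L) else 0)).IsAutomorphicMeasure μH]

-- the closing `exact` identifies the `cmDatum` ∕ `adelicGroupData` currencies (★ `adelicGroupData_eq_cmDatum`, `rfl`), as in ★ p855563
set_option maxHeartbeats 400000 in
include hadm hsc hZ hBsymm hBpos hBinv hu he in
/-- **5R FOR A SUPERCUSPIDAL `ρ₀` OF `U(Φ₂)(L⁺_v)` AT A NON-SPLIT `v`, MODULO (H4) AND (T) ONLY** (ED. 3; [Rogawski1990, §13.8 p. 218 (i)–(iii); Gelbart1975, §10]).  Frame of ★ p855563 at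
`Φ := Φ₂`; hypotheses: `hns` (`v` non-split in `L`), **(H4)** `CuspidalSpectrumDiscrete μH (cmParabolicData L 2)` BY NAME, **(T)** the finite-component token; conclusion = the consequent of
`sig_K2E1GlobaliseSquareIntegrableU2R` for `ρ₀ := [ρ]`.  Proof: ★ p855563 with `hA :=` ★ p855767 `adelicCuspVanishing_cmParabolicData_two` and `hB :=` ★ p855616 `finiteCovolume_cmParabolicData_two`.
[cite: Rogawski1990, §13.8 p. 218 (i)–(iii)] [cite: Gelbart1975, §10 p. 153] [cite: GelfandGraevPiatetskiShapiro1969, Ch. 1 §4] [cite: CasselsFrohlichANT1967, Ch. XV Thm. 4.1.3] -/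
theorem globaliseSupercuspidalU2_of_poincare_nonsplit (hns : ∀ w : PlacesOver L v, IsCMField.complexConj L • w.1 = w.1)
    (hjv : Continuous (((MonoidHom.id ((cmDatum L 2 (Matrix.of fun i j : Fin 2 => if i.val + j.val + 1 = 2 then (1 : L) else 0)).Adelic)).comp ((inclPlaceAdelic (↥(maximalRealSubfield L)) L (IsCMField.complexConj L) 2 (Matrix.of fun i j : Fin 2 => if i.val + j.val + 1 = 2 then (1 : L) else 0) v).comp (localPiEquiv L (IsCMField.complexConj L) 2 (Matrix.of fun i j : Fin 2 => if i.val + j.val + 1 = 2 then (1 : L) else 0) v).symm.toMulEquiv.toMonoidHom)).comp (MonoidHom.id ((cmDatum L 2 (Matrix.of fun i j : Fin 2 => if i.val + j.val + 1 = 2 then (1 : L) else 0)).Local v))))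
    -- (H4) Gelfand–Graev–Piatetski-Shapiro, BY NAME
    (hH4 : (adelicGroupData (↥(maximalRealSubfield L)) L (IsCMField.complexConj L) 2 (Matrix.of fun i j : Fin 2 => if i.val + j.val + 1 = 2 then (1 : L) else 0)).CuspidalSpectrumDiscrete μH (cmParabolicData L 2))
    -- (T) the finite-component ∕ Flath token
    (hTok : ∀ P : DiscreteAutomorphicRep (adelicGroupData (↥(maximalRealSubfield L)) L (IsCMField.complexConj L) 2 (Matrix.of fun i j : Fin 2 => if i.val + j.val + 1 = 2 then (1 : L) else 0)) μH,
      (∃ f : V →ₗ[ℂ] P.space.toSubmodule, f ≠ 0 ∧ ∀ (g : (cmDatum L 2 (Matrix.of fun i j : Fin 2 => if i.val + j.val + 1 = 2 then (1 : L) else 0)).Local v) (x : V), f (ρ g x) = P.space.toContRep ((((MonoidHom.id ((cmDatum L 2 (Matrix.of fun i j : Fin 2 => if i.val + j.val + 1 = 2 then (1 : L) else 0)).Adelic)).comp ((inclPlaceAdelic (↥(maximalRealSubfield L)) L (IsCMField.complexConj L) 2 (Matrix.of fun i j : Fin 2 => if i.val + j.val + 1 = 2 then (1 : L) else 0) v).comp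 (localPiEquiv L (IsCMField.complexConj L) 2 (Matrix.of fun i j : Fin 2 => if i.val + j.val + 1 = 2 then (1 : L) else 0) v).symm.toMulEquiv.toMonoidHom)).comp (MonoidHom.id ((cmDatum L 2 (Matrix.of fun i j : Fin 2 => if i.val + j.val + 1 = 2 then (1 : L) else 0)).Local v))) g) (f x)) →
      (∀ w, w ≠ v → ∃ Kw : Subgroup ((cmDatum L 2 (Matrix.of fun i j : Fin 2 => if i.val + j.val + 1 = 2 then (1 : L) else 0)).Local w), IsOpen (Kw : Set ((cmDatum L 2 (Matrix.of fun i j : Fin 2 => if i.val + j.val + 1 = 2 then (1 : L) else 0)).Local w)) ∧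
        IsCompact (Kw : Set ((cmDatum L 2 (Matrix.of fun i j : Fin 2 => if i.val + j.val + 1 = 2 then (1 : L) else 0)).Local w)) ∧
          ∃ x : P.space.toSubmodule, x ≠ 0 ∧ ∀ k ∈ Kw, P.space.toContRep ((((MonoidHom.id ((cmDatum L 2 (Matrix.of fun i j : Fin 2 => if i.val + j.val + 1 = 2 then (1 : L) else 0)).Adelic)).comp ((inclPlaceAdelic (↥(maximalRealSubfield L)) L (IsCMField.complexConj L) 2 (Matrix.of fun i j : Fin 2 => if i.val + j.val + 1 = 2 then (1 : L) else 0) w).comp (localPiEquiv L (IsCMField.complexConj L) 2 (Matrix.of fun i j : Fin 2 => if i.val + j.val + 1 = 2 then (1 : L) else 0) w).symm.toMulEquiv.toMonoidHom)).comp (MonoidHom.id ((cmDatum L 2 (Matrix.of fun i j : Fin 2 => if i.val + j.val + 1 = 2 then (1 : L) else 0)).Local w))) k) x = x) →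
      ∃ π : ∀ w : HeightOneSpectrum (𝓞 ↥(maximalRealSubfield L)), IrrClass ((cmDatum L 2 (Matrix.of fun i j : Fin 2 => if i.val + j.val + 1 = 2 then (1 : L) else 0)).Local w),
        cmOccursInDiscreteSpectrum L 2 (Matrix.of fun i j : Fin 2 => if i.val + j.val + 1 = 2 then (1 : L) else 0) μH π ∧
          π v = IrrClass.mk { V := V, ρ := ρ, isIrreducible := inferInstance, isSmooth := hadm.isSmooth } ∧
          ∀ w, w ≠ v → ∃ Kw : Subgroup ((cmDatum L 2 (Matrix.of fun i j : Fin 2 => if i.val + j.val + 1 = 2 then (1 : L) else 0)).Local w), IsOpen (Kw : Set ((cmDatum L 2 (Matrix.of fun i j : Fin 2 => if i.val + j.val + 1 = 2 then (1 : L) else 0)).Local w)) ∧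
            IsCompact (Kw : Set ((cmDatum L 2 (Matrix.of fun i j : Fin 2 => if i.val + j.val + 1 = 2 then (1 : L) else 0)).Local w)) ∧ (π w).IsSpherical Kw) :
    ∃ (μH' : Measure (adelicGroupData (↥(maximalRealSubfield L)) L (IsCMField.complexConj L) 2 (Matrix.of fun i j : Fin 2 => if i.val + j.val + 1 = 2 then (1 : L) else 0)).automorphicQuotient)
      (_ : (adelicGroupData (↥(maximalRealSubfield L)) L (IsCMField.complexConj L) 2 (Matrix.of fun i j : Fin 2 => if i.val + j.val + 1 = 2 then (1 : L) else 0)).IsAutomorphicMeasure μH')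
      (π : ∀ w : HeightOneSpectrum (𝓞 ↥(maximalRealSubfield L)), IrrClass ((cmDatum L 2 (Matrix.of fun i j : Fin 2 => if i.val + j.val + 1 = 2 then (1 : L) else 0)).Local w)),
      cmOccursInDiscreteSpectrum L 2 (Matrix.of fun i j : Fin 2 => if i.val + j.val + 1 = 2 then (1 : L) else 0) μH' π ∧
        π v = IrrClass.mk { V := V, ρ := ρ, isIrreducible := inferInstance, isSmooth := hadm.isSmooth } ∧
        ∀ w, w ≠ v → ∃ Kw : Subgroup ((cmDatum L 2 (Matrix.of fun i j : Fin 2 => if i.val + j.val + 1 = 2 then (1 : L) else 0)).Local w), IsOpen (Kw : Set ((cmDatum L 2 (Matrix.of fun i j : Fin 2 => if i.val + j.val + 1 = 2 then (1 : L) else 0)).Local w)) ∧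
          IsCompact (Kw : Set ((cmDatum L 2 (Matrix.of fun i j : Fin 2 => if i.val + j.val + 1 = 2 then (1 : L) else 0)).Local w)) ∧ (π w).IsSpherical Kw :=
  globaliseSupercuspidal_of_poincare L _ v hadm hsc hZ hBsymm hBpos hBinv ν hu e he μH (cmParabolicData L 2) hjv
    (adelicCuspVanishing_cmParabolicData_two L v hns hadm.isSmooth hsc hBsymm hBinv u) (finiteCovolume_cmParabolicData_two L) hH4 hTok

end PhiTwo

end Summit.HodgeConjecture.HodgeConjecture.Cruxes.H413.K2E1GlobaliseSupercuspidalU2PoincareNonsplit
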